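import Literature.Probability.LatticeModels.CollarLegModelConfigs

/-!
# Stub `s17_eventually_configsNonempty` of the D2 completion (line
# `rainbow-monomials-in-excursion-kernels`, crux `BoundaryDefectGaussianR`,
# stmt-CriticalPhenomena-14132) — Part 1: a height configuration exists as soon as the prescribed
# collar data are 1-Lipschitz (the capped multi-source distance transform)

The stub asks for ONE valid height configuration of the jump collar `ι.model V`
(`Literature.Probability.LatticeModels.CollarLegModel`: a configuration assigns an integer to every
FREE cell, and `IsValid` demands `|h x - h f| = 1` for every vertex-cell `x` and every face-cell `f`
at `x` as soon as one of the two is free; non-free cells read the prescribed `vertH` / `faceH`).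
This part isolates the model-independent half of the construction. Put every cell at the doubled
position `2v` (vertex-cell `v`) resp. `2f + (1,1)` (face-cell with bottom-left corner `f`), so that
the cell distance is the sup-norm `D` of the difference (a vertex-cell and a face-cell at it are at
distance `1`, lattice neighbours at distance `2`). For every cell `c` let

  `H c = min (κ c, min over prescribed cells P of (λ P + D c P))`,

`λ` the prescribed level, `κ = 1` on vertex-cells and `0` on face-cells (the far level). Then:
* `H` is 1-Lipschitz across every corner pair (each term is), and `H x` is odd on vertex-cells and
  even on face-cells provided the prescribed vertex levels are odd and the prescribed face levels
  even (the parities of `D`): so `|H x - H f| = 1` at EVERY corner pair (`dt_abs_eq_one`);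
* `H P = λ P` at every prescribed cell as soon as `λ ≤ κ` there and `λ` is 1-Lipschitz for `D`
  (`λ P - λ P' ≤ D P P'`): the minimum is attained at `P` itself.
Hence (`configsNonempty_of_lipschitz`, registered one-line form `s17_configsNonempty_part1`): **if
the prescribed levels of a `CollarLegModel` are odd and `≤ 1` on the prescribed vertex-cells, even
and `≤ 0` on the prescribed face-cells, and 1-Lipschitz for the cell distance, then `configs` is
non-empty** (validity of the restriction of `H` to the free cells; `mem_configs_of_isValid`).
Parts 2ff verify the hypotheses for the jump collar of an admissible flat insertion, eventually
along the mesh sequence. All [folklore] (distance transforms of Lipschitz boundary data).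
-/

namespace Summit.CriticalPhenomena.CardyFormulaZ2.Cruxes.BoundaryDefectGaussianR.RainbowMonomialsInExcursionKernels

open Finset Literature.Probability.LatticeModels Literature.Probability.LatticeModels.CollarLegModel

/-! ### Minima of finite sets of integers -/

/-- Comparison of minima: if every element of `t` exceeds some element of `s` minus one, then
`min s ≤ min t + 1`. [folklore] -/
theorem dt_min'_le_min'_add_one {s t : Finset ℤ} (hs : s.Nonempty) (ht : t.Nonempty)
    (h : ∀ z ∈ t, ∃ w ∈ s, w ≤ z + 1) : s.min' hs ≤ t.min' ht + 1 := by
  obtain ⟨w, hw, hwz⟩ := h _ (t.min'_mem ht)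
  exact (s.min'_le w hw).trans hwz

/-- The minimum of a non-empty set of integers of constant parity has that parity. [folklore] -/
theorem dt_min'_emod_two {s : Finset ℤ} (hs : s.Nonempty) {r : ℤ} (h : ∀ z ∈ s, z % 2 = r) :
    s.min' hs % 2 = r :=
  h _ (s.min'_mem hs)

/-- An attained lower bound is the minimum. [folklore] -/
theorem dt_min'_eq_of_mem {s : Finset ℤ} (hs : s.Nonempty) {v : ℤ} (hv : v ∈ s)
    (hle : ∀ z ∈ s, v ≤ z) : s.min' hs = v :=
  le_antisymm (s.min'_le v hv) (s.le_min' hs v hle)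

/-- Two integers within one of each other, the first odd and the second even, differ by exactly
one. [folklore] -/
theorem dt_abs_eq_one {a b : ℤ} (h1 : a ≤ b + 1) (h2 : b ≤ a + 1) (ha : a % 2 = 1)
    (hb : b % 2 = 0) : |a - b| = 1 := by
  rw [abs_eq (zero_le_one' ℤ)]; omega

/-! ### The cell distance at a corner pair -/

/-- The faces at `x`, in coordinates: bottom-left corner `(x₁ or x₁ - 1, x₂ or x₂ - 1)`. [folklore] -/
theorem dt_vertexFaces_coord {x f : ℤ × ℤ} (hf : f ∈ SixVertex.vertexFaces x) :
    (f.1 = x.1 ∨ f.1 = x.1 - 1) ∧ (f.2 = x.2 ∨ f.2 = x.2 - 1) := by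
  simp only [SixVertex.vertexFaces, mem_insert, mem_singleton] at hf
  obtain ⟨a, b⟩ := x
  rcases hf with rfl | rfl | rfl | rfl <;> simp

/-- Distances from a vertex-cell `x` and from a face-cell `f` at `x` to a vertex-cell `y`: within
one of each other, even resp. odd. [folklore] -/
theorem dt_dist_vertexSource {x f : ℤ × ℤ} (hf : f ∈ SixVertex.vertexFaces x) (y : ℤ × ℤ) :
    max |2 * x.1 - 2 * y.1| |2 * x.2 - 2 * y.2| ≤
        max |2 * f.1 + 1 - 2 * y.1| |2 * f.2 + 1 - 2 * y.2| + 1 ∧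
      max |2 * f.1 + 1 - 2 * y.1| |2 * f.2 + 1 - 2 * y.2| ≤
        max |2 * x.1 - 2 * y.1| |2 * x.2 - 2 * y.2| + 1 ∧
      max |2 * x.1 - 2 * y.1| |2 * x.2 - 2 * y.2| % 2 = 0 ∧
      max |2 * f.1 + 1 - 2 * y.1| |2 * f.2 + 1 - 2 * y.2| % 2 = 1 := by
  obtain ⟨h1, h2⟩ := dt_vertexFaces_coord hf
  simp only [abs_eq_max_neg]
  omega

/-- Distances from a vertex-cell `x` and from a face-cell `f` at `x` to a face-cell `g`: within
one of each other, odd resp. even. [folklore] -/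
theorem dt_dist_faceSource {x f : ℤ × ℤ} (hf : f ∈ SixVertex.vertexFaces x) (g : ℤ × ℤ) :
    max |2 * x.1 - (2 * g.1 + 1)| |2 * x.2 - (2 * g.2 + 1)| ≤
        max |2 * f.1 - 2 * g.1| |2 * f.2 - 2 * g.2| + 1 ∧
      max |2 * f.1 - 2 * g.1| |2 * f.2 - 2 * g.2| ≤
        max |2 * x.1 - (2 * g.1 + 1)| |2 * x.2 - (2 * g.2 + 1)| + 1 ∧
      max |2 * x.1 - (2 * g.1 + 1)| |2 * x.2 - (2 * g.2 + 1)| % 2 = 1 ∧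
      max |2 * f.1 - 2 * g.1| |2 * f.2 - 2 * g.2| % 2 = 0 := by
  obtain ⟨h1, h2⟩ := dt_vertexFaces_coord hf
  simp only [abs_eq_max_neg]
  omega

/-! ### The capped distance transform -/

section Transform

variable (M : CollarLegModel)

/-- **Existence of a height configuration from 1-Lipschitz collar data.** If the prescribed levels
of the non-free vertex-cells are odd and `≤ 1`, those of the non-free face-cells even and `≤ 0`, and
the prescribed levels are 1-Lipschitz for the cell distance (sup-norm of doubled positions, faces
at the doubled centre), then the model has a valid height configuration: the capped distance
transform `H c = min (κ c, min_P (λ P + D c P))` restricted to the free cells. [folklore] -/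
theorem configsNonempty_of_lipschitz
    (hpv : ∀ x ∈ M.vertexCells, (x, false) ∉ M.freeCells → M.C.vertH x % 2 = 1 ∧ M.C.vertH x ≤ 1)
    (hpf : ∀ f ∈ M.faceCells, (f, true) ∉ M.freeCells → M.C.faceH f % 2 = 0 ∧ M.C.faceH f ≤ 0)
    (hvv : ∀ x ∈ M.vertexCells, (x, false) ∉ M.freeCells → ∀ y ∈ M.vertexCells,
      (y, false) ∉ M.freeCells →
      M.C.vertH x - M.C.vertH y ≤ max |2 * x.1 - 2 * y.1| |2 * x.2 - 2 * y.2|)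
    (hvf : ∀ x ∈ M.vertexCells, (x, false) ∉ M.freeCells → ∀ g ∈ M.faceCells,
      (g, true) ∉ M.freeCells →
      |M.C.vertH x - M.C.faceH g| ≤ max |2 * x.1 - (2 * g.1 + 1)| |2 * x.2 - (2 * g.2 + 1)|)
    (hff : ∀ f ∈ M.faceCells, (f, true) ∉ M.freeCells → ∀ g ∈ M.faceCells,
      (g, true) ∉ M.freeCells →
      M.C.faceH f - M.C.faceH g ≤ max |2 * f.1 - 2 * g.1| |2 * f.2 - 2 * g.2|) :
    M.configs.Nonempty := by
  classical
  -- the sources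
  set Sv : Finset (ℤ × ℤ) := M.vertexCells.filter fun x => (x, false) ∉ M.freeCells with hSv
  set Sf : Finset (ℤ × ℤ) := M.faceCells.filter fun f => (f, true) ∉ M.freeCells with hSf
  have mSv : ∀ {y}, y ∈ Sv ↔ y ∈ M.vertexCells ∧ (y, false) ∉ M.freeCells := by
    intro y; rw [hSv, mem_filter]
  have mSf : ∀ {g}, g ∈ Sf ↔ g ∈ M.faceCells ∧ (g, true) ∉ M.freeCells := by
    intro g; rw [hSf, mem_filter]
  -- the candidate values at a vertex-cell `x` and at a face-cell `f`
  set Tv : ℤ × ℤ → Finset ℤ := fun x => insert 1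
    ((Sv.image fun y => M.C.vertH y + max |2 * x.1 - 2 * y.1| |2 * x.2 - 2 * y.2|) ∪
      (Sf.image fun g => M.C.faceH g + max |2 * x.1 - (2 * g.1 + 1)| |2 * x.2 - (2 * g.2 + 1)|))
    with hTv
  set Tf : ℤ × ℤ → Finset ℤ := fun f => insert 0
    ((Sv.image fun y => M.C.vertH y + max |2 * f.1 + 1 - 2 * y.1| |2 * f.2 + 1 - 2 * y.2|) ∪
      (Sf.image fun g => M.C.faceH g + max |2 * f.1 - 2 * g.1| |2 * f.2 - 2 * g.2|))
    with hTf
  have neV : ∀ x, (Tv x).Nonempty := fun x => insert_nonempty _ _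
  have neF : ∀ f, (Tf f).Nonempty := fun f => insert_nonempty _ _
  -- membership in the candidate sets
  have memTv : ∀ {x z}, z ∈ Tv x ↔ z = 1 ∨
      (∃ y ∈ Sv, z = M.C.vertH y + max |2 * x.1 - 2 * y.1| |2 * x.2 - 2 * y.2|) ∨
      (∃ g ∈ Sf, z = M.C.faceH g + max |2 * x.1 - (2 * g.1 + 1)| |2 * x.2 - (2 * g.2 + 1)|) := by
    intro x z
    simp only [hTv, mem_insert, mem_union, mem_image]
    constructor
    · rintro (h | ⟨y, hy, h⟩ | ⟨g, hg, h⟩)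
      · exact Or.inl h
      · exact Or.inr (Or.inl ⟨y, hy, h.symm⟩)
      · exact Or.inr (Or.inr ⟨g, hg, h.symm⟩)
    · rintro (h | ⟨y, hy, h⟩ | ⟨g, hg, h⟩)
      · exact Or.inl h
      · exact Or.inr (Or.inl ⟨y, hy, h.symm⟩)
      · exact Or.inr (Or.inr ⟨g, hg, h.symm⟩)
  have memTf : ∀ {f z}, z ∈ Tf f ↔ z = 0 ∨
      (∃ y ∈ Sv, z = M.C.vertH y + max |2 * f.1 + 1 - 2 * y.1| |2 * f.2 + 1 - 2 * y.2|) ∨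
      (∃ g ∈ Sf, z = M.C.faceH g + max |2 * f.1 - 2 * g.1| |2 * f.2 - 2 * g.2|) := by
    intro f z
    simp only [hTf, mem_insert, mem_union, mem_image]
    constructor
    · rintro (h | ⟨y, hy, h⟩ | ⟨g, hg, h⟩)
      · exact Or.inl h
      · exact Or.inr (Or.inl ⟨y, hy, h.symm⟩)
      · exact Or.inr (Or.inr ⟨g, hg, h.symm⟩)
    · rintro (h | ⟨y, hy, h⟩ | ⟨g, hg, h⟩)
      · exact Or.inl h
      · exact Or.inr (Or.inl ⟨y, hy, h.symm⟩)
      · exact Or.inr (Or.inr ⟨g, hg, h.symm⟩)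
  -- (1) unit differences of the transform at every corner pair
  have hunit : ∀ x f, f ∈ SixVertex.vertexFaces x →
      |(Tv x).min' (neV x) - (Tf f).min' (neF f)| = 1 := by
    intro x f hxf
    refine dt_abs_eq_one ?_ ?_ ?_ ?_
    · refine dt_min'_le_min'_add_one (neV x) (neF f) fun z hz => ?_
      rcases memTf.1 hz with rfl | ⟨y, hy, rfl⟩ | ⟨g, hg, rfl⟩
      · exact ⟨1, memTv.2 (Or.inl rfl), by norm_num⟩
      · refine ⟨_, memTv.2 (Or.inr (Or.inl ⟨y, hy, rfl⟩)), ?_⟩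
        linarith [(dt_dist_vertexSource hxf y).1]
      · refine ⟨_, memTv.2 (Or.inr (Or.inr ⟨g, hg, rfl⟩)), ?_⟩
        linarith [(dt_dist_faceSource hxf g).1]
    · refine dt_min'_le_min'_add_one (neF f) (neV x) fun z hz => ?_
      rcases memTv.1 hz with rfl | ⟨y, hy, rfl⟩ | ⟨g, hg, rfl⟩
      · exact ⟨0, memTf.2 (Or.inl rfl), by norm_num⟩
      · refine ⟨_, memTf.2 (Or.inr (Or.inl ⟨y, hy, rfl⟩)), ?_⟩
        linarith [(dt_dist_vertexSource hxf y).2.1]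
      · refine ⟨_, memTf.2 (Or.inr (Or.inr ⟨g, hg, rfl⟩)), ?_⟩
        linarith [(dt_dist_faceSource hxf g).2.1]
    · refine dt_min'_emod_two (neV x) fun z hz => ?_
      rcases memTv.1 hz with rfl | ⟨y, hy, rfl⟩ | ⟨g, hg, rfl⟩
      · rfl
      · have h1 := (hpv y (mSv.1 hy).1 (mSv.1 hy).2).1
        have h2 := (dt_dist_vertexSource hxf y).2.2.1
        omega
      · have h1 := (hpf g (mSf.1 hg).1 (mSf.1 hg).2).1
        have h2 := (dt_dist_faceSource hxf g).2.2.1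
        omega
    · refine dt_min'_emod_two (neF f) fun z hz => ?_
      rcases memTf.1 hz with rfl | ⟨y, hy, rfl⟩ | ⟨g, hg, rfl⟩
      · rfl
      · have h1 := (hpv y (mSv.1 hy).1 (mSv.1 hy).2).1
        have h2 := (dt_dist_vertexSource hxf y).2.2.2
        omega
      · have h1 := (hpf g (mSf.1 hg).1 (mSf.1 hg).2).1
        have h2 := (dt_dist_faceSource hxf g).2.2.2
        omega
  -- (2) the transform extends the prescribed levels
  have hextV : ∀ x ∈ Sv, (Tv x).min' (neV x) = M.C.vertH x := by
    intro x hx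
    obtain ⟨hxc, hxn⟩ := mSv.1 hx
    refine dt_min'_eq_of_mem (neV x) (memTv.2 (Or.inr (Or.inl ⟨x, hx, by simp⟩))) fun z hz => ?_
    rcases memTv.1 hz with rfl | ⟨y, hy, rfl⟩ | ⟨g, hg, rfl⟩
    · exact (hpv x hxc hxn).2
    · linarith [hvv x hxc hxn y (mSv.1 hy).1 (mSv.1 hy).2]
    · linarith [(abs_le.1 (hvf x hxc hxn g (mSf.1 hg).1 (mSf.1 hg).2)).2]
  have hextF : ∀ f ∈ Sf, (Tf f).min' (neF f) = M.C.faceH f := by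
    intro f hf
    obtain ⟨hfc, hfn⟩ := mSf.1 hf
    refine dt_min'_eq_of_mem (neF f) (memTf.2 (Or.inr (Or.inr ⟨f, hf, by simp⟩))) fun z hz => ?_
    rcases memTf.1 hz with rfl | ⟨y, hy, rfl⟩ | ⟨g, hg, rfl⟩
    · exact (hpf f hfc hfn).2
    · have h1 := (abs_le.1 (hvf y (mSv.1 hy).1 (mSv.1 hy).2 f hfc hfn)).1
      have h2 : max |2 * y.1 - (2 * f.1 + 1)| |2 * y.2 - (2 * f.2 + 1)| =
          max |2 * f.1 + 1 - 2 * y.1| |2 * f.2 + 1 - 2 * y.2| := by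
        rw [abs_sub_comm (2 * y.1), abs_sub_comm (2 * y.2)]
      linarith
    · linarith [hff f hfc hfn g (mSf.1 hg).1 (mSf.1 hg).2]
  -- (3) the configuration and its validity
  set h : ↥M.freeCells → ℤ := fun c =>
    if c.1.2 then (Tf c.1.1).min' (neF c.1.1) else (Tv c.1.1).min' (neV c.1.1) with hh
  have hval : M.IsValid h := by
    intro x hx f hxf hfc _
    have ev : M.hv h x = (Tv x).min' (neV x) := by
      by_cases hfree : (x, false) ∈ M.freeCells
      · rw [hv_of_mem M h hfree]; simp [hh]
      · rw [hv_of_not_mem M h hfree, hextV x (mSv.2 ⟨hx, hfree⟩)]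
    have ef : M.hf h f = (Tf f).min' (neF f) := by
      by_cases hfree : (f, true) ∈ M.freeCells
      · rw [hf_of_mem M h hfree]; simp [hh]
      · rw [hf_of_not_mem M h hfree, hextF f (mSf.2 ⟨hfc, hfree⟩)]
    rw [ev, ef]
    exact hunit x f hxf
  exact ⟨h, mem_configs_of_isValid M hval⟩

end Transform

/-! ### Registered one-line form -/

/-- **Registered sub-goal `s17_configsNonempty_part1`** of `s17_eventually_configsNonempty`
(stmt-CriticalPhenomena-14132): a `CollarLegModel` whose prescribed levels are odd and `≤ 1` on the
non-free vertex-cells, even and `≤ 0` on the non-free face-cells, and 1-Lipschitz for the cell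
distance, has a height configuration (one-line form of `configsNonempty_of_lipschitz`). [folklore] -/
theorem s17_configsNonempty_part1 : ∀ (M : Literature.Probability.LatticeModels.CollarLegModel), (∀ x ∈ M.vertexCells, (x, false) ∉ M.freeCells → M.C.vertH x % 2 = 1 ∧ M.C.vertH x ≤ 1) → (∀ f ∈ M.faceCells, (f, true) ∉ M.freeCells → M.C.faceH f % 2 = 0 ∧ M.C.faceH f ≤ 0) → (∀ x ∈ M.vertexCells, (x, false) ∉ M.freeCells → ∀ y ∈ M.vertexCells, (y, false) ∉ M.freeCells → M.C.vertH x - M.C.vertH y ≤ max |2 * x.1 - 2 * y.1| |2 * x.2 - 2 * y.2|) → (∀ x ∈ M.vertexCells, (x, false) ∉ M.freeCells → ∀ g ∈ M.faceCells, (g, true) ∉ M.freeCells → |M.C.vertH x - M.C.faceH g| ≤ max |2 * x.1 - (2 * g.1 + 1)| |2 * x.2 - (2 * g.2 + 1)|) → (∀ f ∈ M.faceCells, (f, true) ∉ M.freeCells → ∀ g ∈ M.faceCells, (g, true) ∉ M.freeCells → M.C.faceH f - M.C.faceH g ≤ max |2 * f.1 - 2 * g.1| |2 * f.2 - 2 *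 g.2|) → M.configs.Nonempty :=
  fun M hpv hpf hvv hvf hff => configsNonempty_of_lipschitz M hpv hpf hvv hvf hff

end Summit.CriticalPhenomena.CardyFormulaZ2.Cruxes.BoundaryDefectGaussianR.RainbowMonomialsInExcursionKernels
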